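import Summits.ResolutionOfSingularities.ResolutionOfSingularities.Theorems.MarkedTransferCampaignW46MarkedSurfaces
import Summits.ResolutionOfSingularities.ResolutionOfSingularities.Theorems.MarkedTransferCampaignW46HostSurfacesWitness
import HarnessLib

/-!
# [OURS · L1 W4.6 rung (i) SURFACES, host words] A KERNEL WITNESS THAT THE CARTIER BINDER IS GONE — powers of the maximal ideal of a
# closed point of a regular surface are NOT effective Cartier, and `markedOrderReduction_of_dim_le_two` resolves them with any boundary

Cell res-hironaka, LADDER-RESOLUTION rung L (D-0089), slot W4.6, rung (i) SURFACES in the host item's own words; seat res-L1-s46-pv-1 (gen 7).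
`--kind proof --supports` stmt-ResolutionOfSingularities-16156 `--as helper`. NON-VACUITY of the generalisation landed in
`…W46MarkedSurfaces.lean` (`markedOrderReduction_of_dim_le_two`: marked order reduction for EVERY ideal sheaf on a regular surface): the
ideal binder now ranges over ideals that gen 6's `hypersurfaceOrderReductionDimLE_two` (effective Cartier `I`) did not cover. Everything is
OURS, evaluated at EXPLICIT tree objects (the plane specimen `Thm717PlaneSpecimen.Z K = Spec K[x, y]` and its origin `ξ₀`); nothing is a
statement of H. Hironaka's manuscript [Hironaka2017] (the cited `Proofs/…` modules are kernel bookkeeping on explicit specimens). AI-written;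
AI review is weaker than expert review.

## What is proved (no definitions)

* `not_isEffectiveCartier_vanishingIdeal_singleton` — at a closed point `x` with regular two-dimensional local ring, the ideal sheaf
  `𝓘_{x}` of the reduced point is NOT effective Cartier (its stalk `𝔪_x` would be principal, forcing `dim 𝒪_{X,x} ≤ 1`), nor is any
  power `𝓘_{x}ⁿ`, `n ≥ 1` (`…_pow`).
* `exists_isResolutionOf_vanishingIdeal_pow` — for every closed point `x` of codimension two on an integral regular surface over a field,
  every `n ≥ 1`, every snc boundary `E` and every `m ≥ 1`: `(𝓘_{x}ⁿ, E, m)` has a data-level BGMW resolution although `𝓘_{x}ⁿ` is not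
  effective Cartier.
* **`exists_isMarkedResolution_originPow_anyBoundary`** — the explicit instance: on `𝔸²_K` (`K : Type` perfect of characteristic `p`),
  `(𝔪_{origin}ⁿ, E, m)` for `n, m ≥ 1` and ANY snc boundary `E` (e.g. the tangent-parabola boundary of gen 6's witness) has a BGMW
  marked resolution, and `𝔪_{origin}ⁿ` is not effective Cartier.

## Sources

* J. Kollár, *Lectures on Resolution of Singularities* (2007), Thm. 3.107. [Kollar2007]
* E. Bierstone, D. Grigoriev, P. Milman, J. Włodarczyk, arXiv:1206.3090, Def. 3.1.3. [BierstoneGrigorievMilmanWlodarczyk2011]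
* H. Hironaka, ms. 2017-03-23 — scope only, under adjudication, not cited as fact. [Hironaka2017]
-/

noncomputable section

set_option linter.dupNamespace false -- mandated namespace of this single-conjunct summit

open CategoryTheory AlgebraicGeometry TopologicalSpace IsLocalRing

namespace Summit.ResolutionOfSingularities.ResolutionOfSingularities.Theorems

namespace CampaignW46

open Literature.AlgebraicGeometry.Resolution
open Literature.AlgebraicGeometry.Hironaka2017
open Literature.AlgebraicGeometry.Hironaka2017.S07Permissible.Thm717PlaneSpecimen
open Scheme.IdealSheafData

universe u

/-! ## §1 The point ideal of a codimension-two point is not Cartier -/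

/-- **At a closed point `x` with regular local ring of dimension `2`, `𝓘_{x}` is not effective Cartier**: an effective Cartier stalk
is principal, `𝓘_{x},x = 𝔪_x`, and a principal maximal ideal of a regular local ring has `dim = spanFinrank 𝔪_x ≤ 1`. [folklore] -/
theorem not_isEffectiveCartier_vanishingIdeal_singleton {X : Scheme.{u}} {x : X} (hx : IsClosed ({x} : Set X))
    [IsRegularLocalRing (X.presheaf.stalk x)] (h2 : ringKrullDim (X.presheaf.stalk x) = 2) :
    ¬ IsEffectiveCartier (vanishingIdeal ⟨{x}, hx⟩) := by
  intro hC
  obtain ⟨t, -, ht⟩ := hC.exists_stalkIdeal_eq_span x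
  have h𝔪 : stalkIdeal (vanishingIdeal ⟨{x}, hx⟩) x = maximalIdeal (X.presheaf.stalk x) :=
    stalkIdeal_vanishingIdeal_eq_maximalIdeal_of_closure_eq (by rw [hx.closure_eq]; rfl)
  rw [h𝔪] at ht
  have h1 : (maximalIdeal (X.presheaf.stalk x)).spanFinrank ≤ 1 := by
    have h := Submodule.spanFinrank_span_le_encard (R := X.presheaf.stalk x) ({t} : Set (X.presheaf.stalk x))
    rw [Set.encard_singleton] at h
    rw [ht]
    exact_mod_cast h
  have h3 := IsRegularLocalRing.spanFinrank_maximalIdeal (R := X.presheaf.stalk x)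
  rw [h2] at h3
  have h4 : (maximalIdeal (X.presheaf.stalk x)).spanFinrank = 2 := by exact_mod_cast h3
  omega

/-- … nor is any power `𝓘_{x}ⁿ`, `n ≥ 1` (a factor of an effective Cartier product is effective Cartier). [folklore] -/
theorem not_isEffectiveCartier_vanishingIdeal_singleton_pow {X : Scheme.{u}} {x : X} (hx : IsClosed ({x} : Set X))
    [IsRegularLocalRing (X.presheaf.stalk x)] (h2 : ringKrullDim (X.presheaf.stalk x) = 2) {n : ℕ} (hn : 1 ≤ n) :
    ¬ IsEffectiveCartier (vanishingIdeal ⟨{x}, hx⟩ ^ n) := by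
  intro hC
  obtain ⟨d, rfl⟩ : ∃ d, n = d + 1 := ⟨n - 1, by omega⟩
  rw [pow_succ] at hC
  exact not_isEffectiveCartier_vanishingIdeal_singleton hx h2 hC.of_mul_right

/-! ## §2 The generalisation resolves them -/

/-- **[OURS · W4.6 rung (i)] Powers of point ideals on a regular surface are resolved, with any boundary, although they are not
effective Cartier.** `X` integral regular, locally of finite type and quasi-compact over a field `k`, `dim X ≤ 2`; `x` a closed point
with `dim 𝒪_{X,x} = 2`; `n, m ≥ 1`; `E` snc ⟹ `𝓘_{x}ⁿ` is not effective Cartier, and `∃ t : CentreSeq X, t.IsResolutionOf ⟨𝓘_{x}ⁿ, E, m⟩`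
(`markedOrderReduction_of_dim_le_two`). [cite: Kollar2007, Thm. 3.107] [cite: BierstoneGrigorievMilmanWlodarczyk2011, Def. 3.1.3] -/
theorem exists_isResolutionOf_vanishingIdeal_pow {k : Type u} [Field k] (X : Scheme.{u}) (s : X ⟶ Spec (.of k))
    [LocallyOfFiniteType s] [QuasiCompact s] [IsIntegral X] (hreg : Scheme.IsRegular X) (hdim : topologicalKrullDim X ≤ 2)
    {x : X} (hx : IsClosed ({x} : Set X)) (h2 : ringKrullDim (X.presheaf.stalk x) = 2) {n : ℕ} (hn : 1 ≤ n)
    (E : List X.IdealSheafData) (hE : HasSNC E) {m : ℕ} (hm : 1 ≤ m) :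
    ¬ IsEffectiveCartier (vanishingIdeal ⟨{x}, hx⟩ ^ n) ∧
      ∃ t : CentreSeq X, t.IsResolutionOf (⟨vanishingIdeal ⟨{x}, hx⟩ ^ n, E, m⟩ : MarkedIdeal X) := by
  haveI := hreg x
  refine ⟨not_isEffectiveCartier_vanishingIdeal_singleton_pow hx h2 hn, ?_⟩
  -- `{x} ≠ X` (the generic stalk is a field, of dimension `0 ≠ 2`), so `𝓘_{x} ≠ ⊥` and `𝓘_{x}ⁿ ≠ ⊥`
  have hxne : ({x} : Set X) ≠ Set.univ := by
    intro h
    have hg : genericPoint X ∈ ({x} : Set X) := h ▸ Set.mem_univ _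
    rw [Set.mem_singleton_iff] at hg
    have h0 : ringKrullDim (X.presheaf.stalk (genericPoint X)) = 0 := ringKrullDim_eq_zero_of_field X.functionField
    subst hg
    exact absurd (h2.symm.trans h0) (by decide)
  have hP : vanishingIdeal ⟨{x}, hx⟩ ≠ ⊥ := vanishingIdeal_singleton_ne_bot hx hxne
  haveI : IsLocallyNoetherian X := LocallyOfFiniteType.isLocallyNoetherian s
  have hPn : vanishingIdeal ⟨{x}, hx⟩ ^ n ≠ ⊥ := fun h =>
    stalkIdeal_ne_bot_of_ne_bot hP x (by
      have h1 : stalkIdeal (vanishingIdeal ⟨{x}, hx⟩ ^ n) x = ⊥ := by rw [h]; exact stalkIdeal_bot x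
      rw [stalkIdeal_pow] at h1
      exact pow_eq_zero_iff (by omega) |>.mp h1)
  exact markedOrderReduction_of_dim_le_two X s hreg hdim _ hPn E hE m hm

/-! ## §3 The explicit instance: the origin of the plane -/

section Plane

open Literature.AlgebraicGeometry.Hironaka2017.S16Proof LadderWitness

variable (K : Type) [Field K]

/-- The origin `ξ₀` of the plane specimen `𝔸²_K` is a closed point. [folklore] -/
theorem isClosed_origin : IsClosed ({ξ₀ K} : Set (Z K)) := ξ₀_mem_closedPoints K

/-- **[OURS · W4.6 rung (i), host words — witness] THE POWERS OF THE MAXIMAL IDEAL OF THE ORIGIN OF `𝔸²`, WITH ANY SNC BOUNDARY.** For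
`K` perfect of characteristic `p`, `n ≥ 1`, every snc boundary `E` on `𝔸²_K` and every `m ≥ 1`: the ideal sheaf `𝓘_{origin}ⁿ` is NOT
effective Cartier (outside gen 6's rung), and the marked ideal `(𝔸²_K, 𝓘_{origin}ⁿ, E, m)` has a BGMW marked resolution
(`exists_isMarkedResolution_of_dim_le_two`). [cite: Kollar2007, Thm. 3.107] [cite: BierstoneGrigorievMilmanWlodarczyk2011, Def. 3.1.3] -/
theorem exists_isMarkedResolution_originPow_anyBoundary (p : ℕ) [Fact p.Prime] [CharP K p] [PerfectField K] {n : ℕ} (hn : 1 ≤ n)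
    (E : List (Z K).IdealSheafData) (hE : HasSNC E) {m : ℕ} (hm : 1 ≤ m) :
    ¬ IsEffectiveCartier (vanishingIdeal ⟨{ξ₀ K}, isClosed_origin K⟩ ^ n) ∧
      ∃ (X' : Scheme.{0}) (Φ : X' ⟶ Z K) (M' : MarkedIdeal X'),
        IsMarkedResolution (⟨vanishingIdeal ⟨{ξ₀ K}, isClosed_origin K⟩ ^ n, E, m⟩ : MarkedIdeal (Z K)) Φ M' := by
  haveI : LocallyOfFiniteType (hom K) := by rw [hom_eq]; exact locallyOfFiniteType_affineSpace K 2
  haveI : QuasiCompact (hom K) := by rw [hom_eq]; exact quasiCompact_affineSpace K 2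
  haveI : IsIntegral (Z K) := isIntegral_affineSpace K 2
  have hdim : topologicalKrullDim (Z K) ≤ 2 := topologicalKrullDim_affineSpace_le K 2 le_rfl
  have h2 : ringKrullDim ((Z K).presheaf.stalk (ξ₀ K)) = 2 := by
    rw [ringKrullDim_stalk_eq_of_isClosed (hom K) (isClosed_origin K)]
    exact LadderWitness.topologicalKrullDim_affineSpace K 2
  obtain ⟨hnc, t, ht⟩ := exists_isResolutionOf_vanishingIdeal_pow (Z K) (hom K) (isRegular_plane K) hdim (isClosed_origin K) h2 hn
    E hE hm
  exact ⟨hnc, t.top, t.comp, _, ht.isMarkedResolution⟩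

end Plane

end CampaignW46

end Summit.ResolutionOfSingularities.ResolutionOfSingularities.Theorems

end
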